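import Mathlib
import Summits.NavierStokesRegularity.NavierStokesRegularity.Theses.FilamentSkeletonRss
import Literature.Analysis.FluidPDE.GaussianVortexPlanar

/-!
# CoreGluingGivenInvertibilityQ / QR — crux-ideate round 1, ideator 1: first lemmas of the idea cards

Crux `stmt-NavierStokesRegularity-18689` = `…Theses.FilamentSkeletonRss.CoreGluingGivenInvertibilityQ`
(`CoreLinearInvertibility → TransverseReduction`), replaced verbatim-in-mechanism on 2026-08-17T18:22Z by
`stmt-NavierStokesRegularity-19176` = `CoreGluingGivenInvertibilityQR` (`CoreLinearInvertibility →
TransverseReductionR`; the box gains the tilt margin `|⟪X′_j(c_j),e₃⟫| ≤ 1 − θ₀` and the bounds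
`θ₀ ≤ |α|,|γ_j| ≤ θ₀⁻¹`).  Nothing here is proposed to the tree; every `def … : Prop` is the FIRST CHECKABLE
STATEMENT of a line (cards `group-velocity-dichotomy`, `tangent-model-liouville`), typed over existing
declarations (Mathlib + `Literature.Analysis.FluidPDE.GaussianVortexPlanar`) so that a crux-plan seat can
turn it into a stub.
-/

set_option linter.dupNamespace false

noncomputable section

namespace Summit.NavierStokesRegularity.NavierStokesRegularity.Cruxes.CoreGluingGivenInvertibilityQ.Ideator1

open MeasureTheory Real Set Filter Topology
open scoped InnerProductSpace ContDiff

/-- The live successor crux, by name (sanity: the decl a line must conclude; the replaced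
`CoreGluingGivenInvertibilityQ` / `TransverseReduction` decls were removed from the route file at the
2026-08-17T18:22Z repair). -/
example : Theses.FilamentSkeletonRss.CoreGluingGivenInvertibilityQR =
    (Theses.FilamentSkeletonRss.CoreLinearInvertibility →
      Theses.FilamentSkeletonRss.TransverseReductionR) := rfl

/-! ## Card `group-velocity-dichotomy` — two-sided tube inverse from exponential dichotomies in arclength,
end conditions placed by group velocity (Briggs–Bers), sector by sector.

Three model statements, one per kind of sector of the linearised tube operator written as a first-order
system in the arclength `τ` ("spatial dynamics"):

* NEUTRAL, INWARD-PROPAGATING sector (the `m = ±1` helical/displacement band; the tree's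
  `Theorems.stub_inviscidEndHasNeutralMode` shows its end operator `i c ζ″ − w ζ′` is not Volterra in the
  outward direction): `HelicalRadiationInverse` — the correct inverse is the INWARD sweep with the radiation
  condition at the far end, and it is bounded by the tail mass of the forcing;
* DAMPED sectors (every sectional mode off the slow ones; the damping rate is what
  `CoreLinearInvertibility` supplies at a core station): `DampedSectorTwoSidedBound` — elliptic in `τ`,
  no direction needed, a two-sided maximum principle under linear growth of the sweep `w`;
* the abstract engine for a HYPERBOLIC block (Perron; constant coefficients, the frozen-station model):
  `PerronTwoSidedInverse`.
-/

/-- **Radiation inverse of the helical end sector.**  For `c ≠ 0`, continuous `w` and continuous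
integrable forcing `f`, the end equation `i c η′ − w η = f` (`η = ζ′`) has a solution obeying the FAR-END
bound `‖η(τ)‖ ≤ |c|⁻¹ ∫_{(τ,∞)} ‖f‖` (so `η → 0` at `+∞`), and it is the unique solution tending to `0` at
`+∞` (homogeneous solutions have constant modulus, `stub_inviscidEndHasNeutralMode`).  Integrating factor
`e^{−iW/c}`, `W = ∫₀ w`. [folklore] -/
def HelicalRadiationInverse : Prop :=
  ∀ (c : ℝ) (w : ℝ → ℝ) (f : ℝ → ℂ), c ≠ 0 → Continuous w → Continuous f →
    Integrable (fun s => ‖f s‖) →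
    ∃ η : ℝ → ℂ, Differentiable ℝ η ∧
      (∀ τ, (c : ℂ) * Complex.I * deriv η τ - (w τ : ℂ) * η τ = f τ) ∧
      (∀ τ, ‖η τ‖ ≤ |c|⁻¹ * ∫ s in Set.Ioi τ, ‖f s‖) ∧
      ∀ η₂ : ℝ → ℂ, Differentiable ℝ η₂ →
        (∀ τ, (c : ℂ) * Complex.I * deriv η₂ τ - (w τ : ℂ) * η₂ τ = f τ) →
        Tendsto η₂ atTop (𝓝 0) → η₂ = η

/-- **Two-sided bound for a damped swept sector.**  A bounded `C²` solution of
`−η″ + w η′ + a η = f` on `ℝ` with damping `a ≥ a₀ > 0`, sweep of at most linear growth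
`|w(τ)| ≤ C(1+|τ|)` (TransverseReductionR's linear escape) and bounded forcing satisfies
`a₀ sup|η| ≤ sup|f|` — no condition at either end (maximum principle with the barrier `ε log(1+τ²)`).
[folklore] -/
def DampedSectorTwoSidedBound : Prop :=
  ∀ (a₀ C F : ℝ) (w a η f : ℝ → ℝ), 0 < a₀ → (∀ τ, a₀ ≤ a τ) → (∀ τ, |w τ| ≤ C * (1 + |τ|)) →
    (∀ τ, |f τ| ≤ F) → ContDiff ℝ 2 η → (∃ B, ∀ τ, |η τ| ≤ B) →
    (∀ τ, -(deriv (deriv η) τ) + w τ * deriv η τ + a τ * η τ = f τ) →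
    ∀ τ, a₀ * |η τ| ≤ F

/-- **Perron's two-sided inverse (frozen-station engine).**  If the `n × n` complex matrix `A` has no
purely imaginary eigenvalue, then for every continuous forcing with `‖f‖ ≤ 1` the system `y′ = A y + f`
has a bounded solution on `ℝ` with `‖y‖ ≤ K(A)`, unique among bounded solutions (two-sided Green's
function: stable block integrated from `−∞`, unstable block from `+∞`). [cite: Coppel 1978, Lecture
Notes in Math. 629, Prop. 2.1 + §3; Palmer 1984, J. Differ. Equations 55, Lemma 3.4] -/
def PerronTwoSidedInverse (n : ℕ) : Prop :=
  ∀ A : Matrix (Fin n) (Fin n) ℂ, (∀ μ ∈ spectrum ℂ A, μ.re ≠ 0) →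
    ∃ K : ℝ, 0 ≤ K ∧ ∀ f : ℝ → (Fin n → ℂ), Continuous f → (∀ τ, ‖f τ‖ ≤ 1) →
      (∃ y : ℝ → (Fin n → ℂ), (∀ τ, HasDerivAt y (A.mulVec (y τ) + f τ) τ) ∧ ∀ τ, ‖y τ‖ ≤ K) ∧
      ∀ y₁ y₂ : ℝ → (Fin n → ℂ),
        (∀ τ, HasDerivAt y₁ (A.mulVec (y₁ τ) + f τ) τ) → (∃ B, ∀ τ, ‖y₁ τ‖ ≤ B) →
        (∀ τ, HasDerivAt y₂ (A.mulVec (y₂ τ) + f τ) τ) → (∃ B, ∀ τ, ‖y₂ τ‖ ≤ B) → y₁ = y₂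

/-! ## Card `tangent-model-liouville` — Γ-uniformity by contradiction–compactness; each tangent model of a
concentrating failing sequence is excluded by a Liouville (trivial bounded kernel) theorem.

The one tangent model whose Liouville theorem is neither in the tree nor in print is the TILTED core
station (`Negative/AmbientRotationTilt`: at filament `j` the planar operator is `L_λ − ω∂_θ − RΛ_G`,
`ω = −α⟨t,e₃⟩/γ ≠ 0` on every non-horizontal filament — and TransverseReductionR's tilt clause only keeps
`|⟨t,e₃⟩| ≤ 1 − θ₀`, it does not make `ω` zero).  Its first checkable statement is QUALITATIVE injectivity
(no rate, no uniformity — compactness supplies the uniformity on compact `(λ, ω, R)`-sets):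
-/

section Planar

open Literature.Analysis.FluidPDE

/-- Local notation for the cross-section plane. -/
local notation "ℝ²" => EuclideanSpace ℝ (Fin 2)

/-- `∂_θ w = x₀ ∂₁w − x₁ ∂₀w` (generator of rotations about the tube axis). -/
def dTheta (w : ℝ² → ℝ) (x : ℝ²) : ℝ :=
  x 0 * gradient w x 1 - x 1 * gradient w x 0

/-- Exponent data `(p, r, s)` of the tilted Gaussian core of `L_λ − ω∂_θ`
(`Negative/AmbientRotationTilt.gaussianCoreRot_unique`). -/
def tiltP (lam om : ℝ) : ℝ := 1 / 4 + lam / 4 * (1 + 4 * om ^ 2)⁻¹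

@[inherit_doc tiltP] def tiltS (lam om : ℝ) : ℝ := 1 / 4 - lam / 4 * (1 + 4 * om ^ 2)⁻¹

@[inherit_doc tiltP] def tiltR (lam om : ℝ) : ℝ := lam * om / 2 * (1 + 4 * om ^ 2)⁻¹

/-- The inverse tilted-Gaussian weight `e^{+(p x₀² + 2r x₀x₁ + s x₁²)}` (positive definite exponent iff
`λ² < 1 + 4ω²`, `gaussianCoreRot_decaying_iff`); at `ω = 0` it is `gaussWeightLam lam⁻¹` up to a constant. -/
def tiltWeight (lam om : ℝ) (x : ℝ²) : ℝ :=
  Real.exp (tiltP lam om * x 0 ^ 2 + 2 * tiltR lam om * x 0 * x 1 + tiltS lam om * x 1 ^ 2)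

/-- The tilted linearised core operator at the Gaussian of circulation `R`:
`T_{λ,ω,R} w = L_λ w − ω ∂_θ w − R Λ_G w` (`ω = 0` is CoreLinearInvertibility's operator). -/
def tiltedCoreOp (lam om R : ℝ) (w : ℝ² → ℝ) (x : ℝ²) : ℝ :=
  strainedVorticityOperator lam w x - om * dTheta w x
    - R * (⟪gaussVortexVelocity x, gradient w x⟫_ℝ + ⟪biotSavart2D w x, gradient gaussVortexProfile x⟫_ℝ)

/-- **Tilted-core injectivity (Liouville at a tilted core station).**  Inside the Hurwitz window
`λ² < 1 + 4ω²`, for EVERY circulation `R`, the tilted operator `L_λ − ω∂_θ − RΛ_G` has no nonzero `C²`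
solution of `T w = 0` with finite tilted-Gaussian-weighted norm, convergent Biot–Savart integral and zero
mass and first moments.  (`ω = 0`, `|λ| ≪ 1`: Gallay–Wayne 2006 / Maekawa 2009; `ω = 0`, `|λ| < 1`, all
`R`: open — the qualitative shadow of CoreLinearInvertibility; `ω ≠ 0`: new.) [conjecture] -/
def TiltedCoreInjectivity : Prop :=
  ∀ (lam om R : ℝ), lam ^ 2 < 1 + 4 * om ^ 2 →
    ∀ w : ℝ² → ℝ, ContDiff ℝ 2 w →
      Integrable (fun x => tiltWeight lam om x * w x ^ 2) →
      (∀ x, Integrable (fun y => w y • biotSavartKernel2D (x - y))) →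
      ∫ x, w x = 0 → ∫ x, x 0 * w x = 0 → ∫ x, x 1 * w x = 0 →
      (∀ x, tiltedCoreOp lam om R w x = 0) →
      ∀ x, w x = 0

/-- **Compactness upgrade (the form the line consumes at tilted core stations).**  On every compact
parameter set `λ² ≤ 1 + 4ω² − κ`, `|ω| ≤ κ⁻¹`, `|R| ≤ κ⁻¹` there is ONE constant `c > 0` with
`c² ∫ G_{λ,ω}⁻¹ w² ≤ ∫ G_{λ,ω}⁻¹ (T_{λ,ω,R} w)²` on the zero-mass, zero-moment class — injectivity plus
local compactness of the weighted resolvent; the large-`R` end is CoreLinearInvertibility's regime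
(`ω = 0`) and its tilted analogue. [conjecture] -/
def TiltedCoreUniformBound : Prop :=
  ∀ κ : ℝ, 0 < κ → ∃ c : ℝ, 0 < c ∧ ∀ (lam om R : ℝ), lam ^ 2 ≤ 1 + 4 * om ^ 2 - κ → |om| ≤ κ⁻¹ →
    |R| ≤ κ⁻¹ → ∀ w : ℝ² → ℝ, ContDiff ℝ 2 w →
      Integrable (fun x => tiltWeight lam om x * w x ^ 2) →
      (∀ x, Integrable (fun y => w y • biotSavartKernel2D (x - y))) →
      Integrable (fun x => tiltWeight lam om x * tiltedCoreOp lam om R w x ^ 2) →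
      ∫ x, w x = 0 → ∫ x, x 0 * w x = 0 → ∫ x, x 1 * w x = 0 →
      c ^ 2 * ∫ x, tiltWeight lam om x * w x ^ 2 ≤ ∫ x, tiltWeight lam om x * tiltedCoreOp lam om R w x ^ 2

/-- Sanity (no junk in the weight): at `λ = ω = 0` the tilted weight is the Gaussian weight `e^{|x|²/4}`
written in coordinates. -/
theorem tiltWeight_zero_zero (x : ℝ²) :
    tiltWeight 0 0 x = Real.exp ((x 0 ^ 2 + x 1 ^ 2) / 4) := by
  simp only [tiltWeight, tiltP, tiltR, tiltS]
  congr 1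
  ring

/-- Sanity: the tilt vanishes iff `λω = 0` (cf. `gaussianCoreRot_untilted_iff`). -/
theorem tiltR_eq_zero_iff (lam om : ℝ) : tiltR lam om = 0 ↔ lam * om = 0 := by
  have h : (1 + 4 * om ^ 2)⁻¹ ≠ (0 : ℝ) := (inv_pos.2 (by positivity)).ne'
  rw [tiltR, mul_eq_zero, div_eq_zero_iff]
  constructor
  · rintro (h0 | h0)
    · rcases h0 with h0 | h0
      · exact h0
      · norm_num at h0
    · exact absurd h0 h
  · intro h0
    exact Or.inl (Or.inl h0)

end Planar

end Summit.NavierStokesRegularity.NavierStokesRegularity.Cruxes.CoreGluingGivenInvertibilityQ.Ideator1
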